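/-
Copyright (c) 2026 the pub-hodgecm-mathlib formalisation cell (harness21).  Prover seat hodgecm-mathlib-LH4-p08 (g5), Track A «(D-RAM) FOUR-FRAME», unit U2H, the census leaf
(ρ2b′-X) `stub_U2H_fixedPointCensus_typeTwo_unit0` — payer LH4-p14 (g4) 05:57:21Z brick (a) «RIDER (S1′) TYPE-FREE»: the level sets are finite for EVERY descent type.  2026-09-04.
-/
import Summits.HodgeConjecture.HodgeConjecture.Theorems.F0P3cDyRamToricCensusDefs     -- ★ p857239 (LH4-p12 (g4)): `IsOrd`, `dualGen`, `levelSet`, `levelSetDep`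
import Literature.NumberTheory.LocalFields.QuadraticOrderLatticeClasses                -- ★ p857298 (F1): lattices ↔ cosets of the order units, `ncard_image_mk_smul_subgroup`
import Literature.NumberTheory.LocalFields.WildQuadraticDatumUnitDepthIndex            -- ★ p857227: `exists_subgroup_v_eq_one`, `range_units_map_subtype` (units plumbing `𝒪[K]ˣ ↪ Kˣ`)
import Literature.NumberTheory.GaloisRepresentations.CompleteLocalFiniteLevels         -- ★ `CompleteLocalRing.finite_quotient_maximalIdeal_pow` (`𝒪 ⧸ 𝓂ⁿ` finite)
import HarnessLib

/-!
# The level sets of the toric census are FINITE — type-free (any `ϖE`, any `h`, any `α`; no residue-field size, no uniformiser normalisation)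

For the ★ DEFS `levelSet ρ Θ α ϖE h j a` (order lattices `x₀·𝒪_j`, `𝒪_j = {z : |z| ≤ 1, |z − ρz| ≤ |ϖE^j(α − ρα)|}`, with integral Gram-primitive dual generator
`y = h·x₀Θx₀·ϖE^j(α − ρα)` of level `|y| = |ϖE|^a`), and isometries `ρ`, `Θ` of a `ℤᵐ⁰`-valued field whose valuation ring is a DVR with FINITE residue field:
`(levelSet ρ Θ α ϖE h j a).Finite`.  MECHANISM: (i) if the scalar `h·ϖE^j(α − ρα)` vanishes there is no member (`y = 0` is never Gram-primitive); (ii) otherwise the level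
equation pins `|x₀|`, so the generator classes modulo the order units `H = 𝒪_jˣ` (★ F1 `ncard_setOf_orderLattice_eq_ncard_image_mk`) lie in the image of ONE coset `x₀·U`;
(iii) `[U : H] < ∞` TYPE-FREE: `H` contains the congruence subgroup `U ∩ (1 + 𝓂ⁿ)` as soon as `𝓂ⁿ ⊆ {|·| ≤ |ϖE^j(α − ρα)|}`, and `U ∕ (1 + 𝓂ⁿ) ↪ (𝒪 ⧸ 𝓂ⁿ)ˣ` is finite
(★ `finite_quotient_maximalIdeal_pow`).  This is payer LH4-p14 (g4)'s rider (S1′) for the all-types bridge (C″⁺) → (C″): the type-U ★ `levelSet_finite` (p857742) needs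
`|α − ρα| = 1`, `|ϖE| = exp(−1)`, `#𝓀 = q²`, none of which hold on the RamK ∕ RamM classes.
HONEST LABEL: HC_CM is proved only modulo the 7 printed citations (2 remaining named inputs: hLiu418 = stmt-HodgeConjecture-24832,
h413 = stmt-HodgeConjecture-24833) until rung 0 closes; (ρ2b′-X) :418 is an OPEN prover target — this file is a helper (`--supports`), proofs only.
-/

set_option autoImplicit false

open WithZero IsLocalRing
open scoped Valued Pointwise

namespace Summit.HodgeConjecture.HodgeConjecture.Cruxes.H413.F0P3cDyRamToricLevelSetFinite

open Summit.HodgeConjecture.HodgeConjecture.Cruxes.H413.F0P3cDyRamToricCensusDefs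
open Literature.NumberTheory.LocalFields.QuadraticOrder Literature.NumberTheory.LocalFields.WildQuadraticDatum
open Literature.NumberTheory.GaloisRepresentations

variable {K : Type*} [Field K] [Valued K ℤᵐ⁰] {ρ Θ : K →+* K} {α : K}

/-! ## §1 The order units have finite index in the units — type-free -/

/-- **`[U_M : 𝒪_cˣ] < ∞`, TYPE-FREE.**  For an isometry `ρ`, a scalar `c` with `c·(α − ρα) ≠ 0`, and subgroups `U, H ≤ Kˣ` with `u ∈ U ↔ |u| = 1`,
`u ∈ H ↔ |u| = 1 ∧ |u − ρu| ≤ |c(α − ρα)|`: `H.relIndex U ≠ 0` — `H ⊇` the image of `ker(𝒪ˣ → (𝒪 ⧸ 𝓂ⁿ)ˣ)` for `exp(−n) ≤ |c(α − ρα)|` (`|u − ρu| ≤ |u − 1|`), and that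
kernel has finite index since `𝒪 ⧸ 𝓂ⁿ` is finite. [cite: Serre1979, Ch. IV §2 Prop. 6] [cite: Flicker1998UnitaryFL, p. 84] -/
theorem relIndex_orderUnits_ne_zero (hvρ : ∀ x, Valued.v (ρ x) = Valued.v x) [IsDiscreteValuationRing 𝒪[K]] [Finite 𝓀[K]]
    {c : K} (hc : c * (α - ρ α) ≠ 0) (U H : Subgroup Kˣ) (hU : ∀ u, u ∈ U ↔ Valued.v (u : K) = 1)
    (hH : ∀ u : Kˣ, u ∈ H ↔ Valued.v (u : K) = 1 ∧ Valued.v ((u : K) - ρ u) ≤ Valued.v (c * (α - ρ α))) : H.relIndex U ≠ 0 := by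
  classical
  have hvO : Valued.v.Integers 𝒪[K] := Valuation.integer.integers _
  -- the depth `n` with `exp(−n) ≤ |c(α − ρα)|`
  obtain ⟨e, he⟩ : ∃ e : ℤ, Valued.v (c * (α - ρ α)) = exp e := ⟨_, (exp_log ((Valuation.ne_zero_iff _).2 hc)).symm⟩
  obtain ⟨p, hp⟩ := IsDiscreteValuationRing.exists_irreducible 𝒪[K]
  have hvp : Valued.v (p : K) < 1 := lt_of_le_of_ne (hvO.map_le_one p) (mt hvO.isUnit_iff_valuation_eq_one.mpr hp.not_isUnit)
  have hvp' : Valued.v (p : K) ≤ exp (-1 : ℤ) := by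
    rcases eq_or_ne (Valued.v (p : K)) 0 with h0 | h0
    · rw [h0]; exact zero_le
    · rw [← exp_log h0, ← exp_zero, exp_lt_exp] at hvp
      rw [← exp_log h0, exp_le_exp]; omega
  obtain ⟨n, hn⟩ : ∃ n : ℕ, exp (-(n : ℤ)) ≤ Valued.v (c * (α - ρ α)) := ⟨(-e).toNat, by rw [he, exp_le_exp]; omega⟩
  -- the units plumbing
  haveI : Finite (𝒪[K] ⧸ maximalIdeal 𝒪[K] ^ n) := CompleteLocalRing.finite_quotient_maximalIdeal_pow n
  set f : (𝒪[K])ˣ →* Kˣ := Units.map (𝒪[K]).subtype.toMonoidHom with hf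
  set Φ : (𝒪[K])ˣ →* (𝒪[K] ⧸ maximalIdeal 𝒪[K] ^ n)ˣ := Units.map (Ideal.Quotient.mk (maximalIdeal 𝒪[K] ^ n)).toMonoidHom with hΦ
  obtain ⟨hrange, hinj⟩ := range_units_map_subtype (K := K) U hU
  have hUtop : U = (⊤ : Subgroup (𝒪[K])ˣ).map f := by rw [← MonoidHom.range_eq_map, hrange]
  have hker : Φ.ker.index ≠ 0 := by rw [Subgroup.index_ker]; exact Nat.card_pos.ne'
  -- `(ker Φ).map f ≤ H`
  have hle : Φ.ker.map f ≤ H := by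
    rintro u ⟨w, hw, rfl⟩
    rw [SetLike.mem_coe, MonoidHom.mem_ker] at hw
    have h1 : Ideal.Quotient.mk (maximalIdeal 𝒪[K] ^ n) (w : 𝒪[K]) = 1 := by
      have := congrArg (fun z : (𝒪[K] ⧸ maximalIdeal 𝒪[K] ^ n)ˣ => (z : 𝒪[K] ⧸ maximalIdeal 𝒪[K] ^ n)) hw
      simpa [hΦ, Units.coe_map] using this
    rw [← (Ideal.Quotient.mk (maximalIdeal 𝒪[K] ^ n)).map_one, Ideal.Quotient.eq, hp.maximalIdeal_eq, Ideal.span_singleton_pow,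
      Ideal.mem_span_singleton] at h1
    obtain ⟨y, hy⟩ := h1
    have hw1 : Valued.v (((w : 𝒪[K]) : K) - 1) ≤ Valued.v (c * (α - ρ α)) := by
      have hcoe : (((w : 𝒪[K]) : K) - 1) = (p : K) ^ n * (y : K) := by
        have := congrArg (fun z : 𝒪[K] => (z : K)) hy
        simpa using this
      rw [hcoe, map_mul, map_pow]
      refine le_trans ?_ hn
      calc Valued.v (p : K) ^ n * Valued.v (y : K) ≤ exp (-1 : ℤ) ^ n * 1 := mul_le_mul' (pow_le_pow_left' hvp' n) (hvO.map_le_one y)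
        _ = exp (-(n : ℤ)) := by rw [mul_one, ← exp_nsmul, nsmul_eq_mul, mul_neg, mul_one]
    have hwu : Valued.v ((f w : Kˣ) : K) = 1 := hvO.isUnit_iff_valuation_eq_one.mp w.isUnit
    rw [hH]
    refine ⟨hwu, ?_⟩
    have hsub : ((f w : Kˣ) : K) - ρ ((f w : Kˣ) : K) = ((((w : 𝒪[K]) : K) - 1)) - ρ (((w : 𝒪[K]) : K) - 1) := by
      rw [map_sub, map_one]; simp [hf]
    rw [hsub]
    exact (Valuation.map_sub _ _ _).trans (max_le hw1 (by rw [hvρ]; exact hw1))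
  -- conclude: `H.relIndex U ∣ (ker Φ).index ≠ 0`
  have hidx : (Φ.ker.map f).relIndex U = Φ.ker.index := by
    rw [hUtop, Subgroup.relIndex_map_map_of_injective _ _ hinj, Subgroup.relIndex_top_right]
  have hdvd := Subgroup.relIndex_dvd_of_le_left U hle
  rw [hidx] at hdvd
  intro h0
  rw [h0, zero_dvd_iff] at hdvd
  exact hker hdvd

/-! ## §2 The level sets are finite — type-free -/

/-- **THE LEVEL SETS ARE FINITE, TYPE-FREE (payer's rider (S1′)).**  For isometries `ρ`, `Θ` of `K` with `𝒪[K]` a DVR with finite residue field, and ANY `α ϖE h : K`,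
`j a : ℕ`: `(levelSet ρ Θ α ϖE h j a).Finite`.  (Degenerate scalars — `h = 0`, `ϖE^j = 0`, `α = ρα` — give the empty set: `y = 0` fails Gram-primitivity; otherwise the level
equation pins `|x₀|` and §1 bounds the classes.)  At every descent type of the census (U, RamK, RamM) this discharges ★ (C1) p857559's `hfinLS` ∕ the payer's `hS1` by name.
[cite: Flicker1998UnitaryFL, p. 84] [cite: Jacobowitz1962, §4] [cite: Kottwitz1986BaseChangeUnits, §1 pp. 240–241] -/
theorem levelSet_finite' (hvρ : ∀ x, Valued.v (ρ x) = Valued.v x) (hvΘ : ∀ x, Valued.v (Θ x) = Valued.v x)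
    [IsDiscreteValuationRing 𝒪[K]] [Finite 𝓀[K]] (ϖE h : K) (j a : ℕ) : (levelSet ρ Θ α ϖE h j a).Finite := by
  classical
  obtain ⟨U, hU⟩ := exists_subgroup_v_eq_one (K := K)
  obtain ⟨H, hH⟩ := exists_subgroup_orderUnits (ρ := ρ) (α := α) hvρ (ϖE ^ j)
  -- the level set in ★ F1's shape
  set P : Kˣ → Prop := fun x₀ => IsOrd ρ α (ϖE ^ j) (dualGen ρ Θ α (ϖE ^ j) h x₀) ∧ ¬ IsOrd ρ α (ϖE ^ j) (dualGen ρ Θ α (ϖE ^ j) h x₀ / ϖE) ∧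
    Valued.v (dualGen ρ Θ α (ϖE ^ j) h x₀) = Valued.v ϖE ^ a with hPdef
  have hLS : levelSet ρ Θ α ϖE h j a = {Λ : AddSubgroup K | ∃ x₀ : Kˣ, P x₀ ∧
      ∀ x, x ∈ Λ ↔ ∃ y, (Valued.v y ≤ 1 ∧ Valued.v (y - ρ y) ≤ Valued.v (ϖE ^ j * (α - ρ α))) ∧ x = (x₀ : K) * y} := by
    ext Λ
    constructor
    · rintro ⟨x₀, hx₀, hmem, hP⟩
      exact ⟨Units.mk0 x₀ hx₀, hP, hmem⟩
    · rintro ⟨x₀, hP, hmem⟩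
      exact ⟨x₀, x₀.ne_zero, hmem, hP⟩
  by_contra hinf
  have h0 : (levelSet ρ Θ α ϖE h j a).ncard = 0 := Set.Infinite.ncard hinf
  obtain ⟨Λ, hΛ⟩ := Set.Infinite.nonempty hinf
  rw [hLS] at h0 hΛ
  rw [ncard_setOf_orderLattice_eq_ncard_image_mk hvρ hH P] at h0
  obtain ⟨x₀, hPx₀, -⟩ := hΛ
  have hPx₀' : IsOrd ρ α (ϖE ^ j) (dualGen ρ Θ α (ϖE ^ j) h x₀) ∧ ¬ IsOrd ρ α (ϖE ^ j) (dualGen ρ Θ α (ϖE ^ j) h x₀ / ϖE) ∧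
      Valued.v (dualGen ρ Θ α (ϖE ^ j) h x₀) = Valued.v ϖE ^ a := hPx₀
  obtain ⟨-, hN, hE⟩ := hPx₀'
  -- (i) degenerate scalars: `y = 0` is never Gram-primitive
  by_cases hdeg : h * (ϖE ^ j * (α - ρ α)) = 0
  · have hy0 : dualGen ρ Θ α (ϖE ^ j) h x₀ = 0 := by
      rw [dualGen_def, mul_assoc, mul_comm ((x₀ : K) * Θ x₀), ← mul_assoc, hdeg, zero_mul]
    refine hN ⟨?_, ?_⟩
    · rw [hy0, zero_div, map_zero]; exact zero_le
    · rw [hy0, zero_div, map_zero, sub_zero, map_zero]; exact zero_le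
  -- (ii) the level equation pins `|x₀|`: the classes lie in `mk '' (x₀ • U)`, finite by §1
  have hc0 : ϖE ^ j * (α - ρ α) ≠ 0 := right_ne_zero_of_mul hdeg
  have hh0 : h ≠ 0 := left_ne_zero_of_mul hdeg
  have hvc0 : Valued.v (ϖE ^ j * (α - ρ α)) ≠ 0 := (Valuation.ne_zero_iff _).2 hc0
  have hvh0 : Valued.v h ≠ 0 := (Valuation.ne_zero_iff _).2 hh0
  obtain ⟨e₀, he₀⟩ : ∃ e : ℤ, Valued.v (x₀ : K) = exp e := ⟨_, (exp_log ((Valuation.ne_zero_iff _).2 x₀.ne_zero)).symm⟩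
  have hfin : ((QuotientGroup.mk : Kˣ → Kˣ ⧸ H) '' (x₀ • (U : Set Kˣ))).Finite :=
    Set.finite_of_ncard_ne_zero (by rw [ncard_image_mk_smul_subgroup H U x₀]; exact relIndex_orderUnits_ne_zero hvρ hc0 U H hU hH)
  have hempty := (Set.ncard_eq_zero ?_).1 h0
  swap
  · refine hfin.subset (Set.image_mono fun x₁ hx₁ => ?_)
    have hPx₁ : IsOrd ρ α (ϖE ^ j) (dualGen ρ Θ α (ϖE ^ j) h x₁) ∧ ¬ IsOrd ρ α (ϖE ^ j) (dualGen ρ Θ α (ϖE ^ j) h x₁ / ϖE) ∧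
        Valued.v (dualGen ρ Θ α (ϖE ^ j) h x₁) = Valued.v ϖE ^ a := hx₁
    have hE₁ := hPx₁.2.2
    have hsq : Valued.v (x₁ : K) * Valued.v (x₁ : K) = Valued.v (x₀ : K) * Valued.v (x₀ : K) := by
      have h1 := hE₁
      have h2 := hE
      rw [dualGen_def, map_mul, map_mul, map_mul, hvΘ] at h1 h2
      exact mul_left_cancel₀ hvh0 (mul_right_cancel₀ hvc0 (h1.trans h2.symm))
    obtain ⟨e₁, he₁⟩ : ∃ e : ℤ, Valued.v (x₁ : K) = exp e := ⟨_, (exp_log ((Valuation.ne_zero_iff _).2 x₁.ne_zero)).symm⟩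
    rw [he₁, he₀, ← exp_add, ← exp_add, exp_inj] at hsq
    rw [Set.mem_smul_set_iff_inv_smul_mem, smul_eq_mul, SetLike.mem_coe, hU, Units.val_mul, Units.val_inv_eq_inv_val,
      map_mul, map_inv₀, he₁, he₀, ← exp_neg, ← exp_add, ← exp_zero, exp_inj]
    omega
  have hmem : x₀ ∈ (∅ : Set Kˣ) := by
    rw [← Set.image_eq_empty.1 hempty]
    exact hPx₀
  exact (Set.mem_empty_iff_false _).1 hmem

/-- **(S1′, dep)** `levelSetDep(j,a;μ) ⊆ levelSet(j,a)` is finite, type-free. [cite: Jacobowitz1962, §4] -/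
theorem levelSetDep_finite' (hvρ : ∀ x, Valued.v (ρ x) = Valued.v x) (hvΘ : ∀ x, Valued.v (Θ x) = Valued.v x)
    [IsDiscreteValuationRing 𝒪[K]] [Finite 𝓀[K]] (ϖE h : K) (j a : ℕ) (μ : K) : (levelSetDep ρ Θ α ϖE h j a μ).Finite :=
  (levelSet_finite' hvρ hvΘ ϖE h j a).subset fun _ hΛ => hΛ.1

end Summit.HodgeConjecture.HodgeConjecture.Cruxes.H413.F0P3cDyRamToricLevelSetFinite
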